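import Mathlib
import HarnessLib
import Summits.HubbardSuperconductivity.HubbardSuperconductivity.Theorems.KLProgrammeKLRegimeWickCrossContractionGramHybrid

/-!
# Route `KLProgramme` — ENGINE child gen 8 (stmt-HubbardSuperconductivity-20437 `KLRegimeEngineV17F2`), stub (c) v2 class #3 (E.5 share), PROVING side:
# the HYBRID two-vertex bridge in ENGINE CURRENCY (vertex sizes = `ε·hubbardSectorKernelNorm` at the value-form prescriptions), both pinnings
# (cell gate-hubbard-kl, seat p5 g8; sequel to `…WickCrossContractionGramHybrid`; cure of FINDING (E5-VOL))

* §1 the vertex sizes of a sector preimage with output LABELS prescribed and output POSITIONS summed: `sum_pinned_labels_norm_kernel_sectorPreimage_le`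
  (pinned at an output leg, contracted legs free) and `sum_sum_sum_filter_castLE_labels_norm_kernel_sectorPreimage_le` (pinned at the line-`0` leg WITH
  its label prescribed — so it counts in the level — explicit contracted sectors prescribed), both via
  `…CrossContractionNorms.sum_filter_prescribed_norm_kernel_sectorPreimage_le`: `≤ ε·‖G‖_{prescribedTuples univ Ωe}`;
* §2 the family-keyed hybrid bridge pinned at a free leg of `b` (`sum_norm_kernel_crossContract_pullback_le_gramF_labels_of_b`, from `…GramHybrid` §3);
* §3 ENGINE CURRENCY: `sum_norm_kernel_crossContract_sectorPreimage_le_gramF_labels` (pinned at an output leg of `Ga`) and `…_of_b` (pinned at an output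
  leg of `Gb`) — the per-`k` bridges the assembled tails of `…GramTailHybrid` sum.

Pure bookkeeping over landed theorems; no definitions, no named facts, nothing about the model's sizes is asserted; nothing asserts superconductivity.
-/

noncomputable section

namespace Summit.HubbardSuperconductivity.HubbardSuperconductivity.Theorems.KLRegimeWick

set_option linter.dupNamespace false -- summit = problem name (single-conjunct summit), D-0017

open Literature.MathematicalPhysics.QuantumLattice Literature.Probability.LatticeModels GrassmannAlgebra Finset Matrix Nat
open Summit.HubbardSuperconductivity.HubbardSuperconductivity.Theorems.KLRegimeSplit
open scoped InnerProductSpace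

/-! ## §1 Vertex sizes of a sector preimage, output labels prescribed -/

section Preimage

variable {L M N : ℕ} [NeZero L]

/-- **`Na` of the hybrid form**: `a = sectorPreimage β F G` pinned at its output leg `p₀`, its output labels prescribed (`σ₀`), its `n₁` contracted
legs free: `Σ_X Σ_{X₀ : X₀ p₀ = z, (X₀ j).2 = σ₀ j} ‖kernel (sectorPreimage β F G) (n₁+m₀) (append X X₀)‖ ≤ ε_x·‖G‖_{prescribedTuples univ (none^{n₁}, some∘σ₀)}`. -/
theorem sum_pinned_labels_norm_kernel_sectorPreimage_le {β : ℝ} (hβ : 0 ≤ β) (F : Fin N → FreqMomentum L M → ℂ) (G : HubbardGrassmann L M)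
    {n₁ m₀ : ℕ} (p₀ : Fin m₀) (z : SpaceTimeIdx L M × SectorLeg N) (σ₀ : Fin m₀ → SectorLeg N) :
    ∑ X : Fin n₁ → SpaceTimeIdx L M × SectorLeg N,
      ∑ X₀ ∈ univ.filter (fun X₀ : Fin m₀ → SpaceTimeIdx L M × SectorLeg N => X₀ p₀ = z ∧ ∀ j, (X₀ j).2 = σ₀ j),
        ‖kernel ℂ (sectorPreimage β F G) (n₁ + m₀) (Fin.append X X₀)‖ ≤
      imagTimeWeight β M * hubbardSectorKernelNorm L M β F (prescribedTuples univ
        (Fin.append (fun _ : Fin n₁ => (none : Option (SectorLeg N))) (fun j => some (σ₀ j)))) G := by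
  classical
  -- glue the two blocks
  have hglue : ∑ X : Fin n₁ → SpaceTimeIdx L M × SectorLeg N,
      ∑ X₀ ∈ univ.filter (fun X₀ : Fin m₀ → SpaceTimeIdx L M × SectorLeg N => X₀ p₀ = z ∧ ∀ j, (X₀ j).2 = σ₀ j),
        ‖kernel ℂ (sectorPreimage β F G) (n₁ + m₀) (Fin.append X X₀)‖ =
      ∑ W ∈ univ.filter (fun W : Fin (n₁ + m₀) → SpaceTimeIdx L M × SectorLeg N =>
        W (Fin.natAdd n₁ p₀) = z ∧ ∀ j, (W (Fin.natAdd n₁ j)).2 = σ₀ j), ‖kernel ℂ (sectorPreimage β F G) (n₁ + m₀) W‖ := by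
    simp_rw [sum_filter]
    rw [← sum_sum_append_eq]
    refine sum_congr rfl fun X _ => sum_congr rfl fun X₀ _ => ?_
    simp only [Fin.append_right]
  rw [hglue]
  refine le_trans (sum_le_sum_of_subset_of_nonneg (fun W hW => ?_) fun _ _ _ => norm_nonneg _)
    (sum_filter_prescribed_norm_kernel_sectorPreimage_le hβ F G (Fin.natAdd n₁ p₀) z _)
  simp only [mem_filter, mem_univ, true_and] at hW ⊢
  obtain ⟨h0, hlab⟩ := hW
  refine ⟨h0, fun i => Fin.addCases (fun i' => ?_) (fun j => ?_) i⟩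
  · intro t ht
    simp [Fin.append_left] at ht
  · intro t ht
    simp only [Fin.append_right, Option.mem_def, Option.some.injEq] at ht
    rw [← ht, hlab j]

/-- **`Nb` of the hybrid form**: `b = sectorPreimage β F G` pinned at its line-`0` leg `Y₀` (its label PRESCRIBED `some Y₀.2`, so it counts in the level),
the sectors `τ'` of its explicit legs `1 … e'` prescribed, its Gram legs free, its output POSITIONS summed with output labels prescribed (`σ₁`):
`Σ_y Σ_{Y₁ : (Y₁ j).2 = σ₁ j} Σ_{fibre} ‖kernel (sectorPreimage β F G) (k+m₁) (append Y Y₁)‖ ≤ ε_x·‖G‖_{prescribedTuples univ Ω}`,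
`Ω = (some Y₀.2, some ∘ τ', none^{k−e'−1}, some ∘ σ₁)`. -/
theorem sum_sum_sum_filter_castLE_labels_norm_kernel_sectorPreimage_le {β : ℝ} (hβ : 0 ≤ β) (F : Fin N → FreqMomentum L M → ℂ)
    (G : HubbardGrassmann L M) {k e' m₁ : ℕ} (he : e' + 1 ≤ k) (Y₀ : SpaceTimeIdx L M × SectorLeg N) (τ' : Fin e' → SectorLeg N)
    (σ₁ : Fin m₁ → SectorLeg N) :
    ∑ y : Fin e' → SpaceTimeIdx L M,
      ∑ Y₁ ∈ univ.filter (fun Y₁ : Fin m₁ → SpaceTimeIdx L M × SectorLeg N => ∀ j, (Y₁ j).2 = σ₁ j),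
        ∑ Y ∈ univ.filter (fun Y : Fin k → SpaceTimeIdx L M × SectorLeg N =>
          (fun i => Y (Fin.castLE he i)) = (Fin.cons Y₀ (fun i => (y i, τ' i)) : Fin (e' + 1) → SpaceTimeIdx L M × SectorLeg N)),
            ‖kernel ℂ (sectorPreimage β F G) (k + m₁) (Fin.append Y Y₁)‖ ≤
      imagTimeWeight β M * hubbardSectorKernelNorm L M β F (prescribedTuples univ
        (Fin.append (fun i : Fin k => if h : (i : ℕ) < e' + 1 then
          (Fin.cons (some Y₀.2) (fun j => some (τ' j)) : Fin (e' + 1) → Option (SectorLeg N)) ⟨i, h⟩ else none)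
          (fun j => some (σ₁ j)))) G := by
  classical
  -- swap the output sum inward and un-fibre the explicit block
  have hswap : ∑ y : Fin e' → SpaceTimeIdx L M,
      ∑ Y₁ ∈ univ.filter (fun Y₁ : Fin m₁ → SpaceTimeIdx L M × SectorLeg N => ∀ j, (Y₁ j).2 = σ₁ j),
        ∑ Y ∈ univ.filter (fun Y : Fin k → SpaceTimeIdx L M × SectorLeg N =>
          (fun i => Y (Fin.castLE he i)) = (Fin.cons Y₀ (fun i => (y i, τ' i)) : Fin (e' + 1) → SpaceTimeIdx L M × SectorLeg N)),
            ‖kernel ℂ (sectorPreimage β F G) (k + m₁) (Fin.append Y Y₁)‖ =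
      ∑ Y ∈ univ.filter (fun Y : Fin k → SpaceTimeIdx L M × SectorLeg N =>
        Y (Fin.castLE he 0) = Y₀ ∧ ∀ i' : Fin (e' + 1), (Y (Fin.castLE he i')).2 = (Fin.cons Y₀.2 τ' : Fin (e' + 1) → SectorLeg N) i'),
          ∑ Y₁ ∈ univ.filter (fun Y₁ : Fin m₁ → SpaceTimeIdx L M × SectorLeg N => ∀ j, (Y₁ j).2 = σ₁ j),
            ‖kernel ℂ (sectorPreimage β F G) (k + m₁) (Fin.append Y Y₁)‖ := by
    rw [← sum_sum_filter_castLE_eq_sum_filter he Y₀ τ']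
    exact sum_congr rfl fun y _ => by rw [sum_comm]
  -- glue the two blocks
  have hglue : ∑ Y ∈ univ.filter (fun Y : Fin k → SpaceTimeIdx L M × SectorLeg N =>
        Y (Fin.castLE he 0) = Y₀ ∧ ∀ i' : Fin (e' + 1), (Y (Fin.castLE he i')).2 = (Fin.cons Y₀.2 τ' : Fin (e' + 1) → SectorLeg N) i'),
          ∑ Y₁ ∈ univ.filter (fun Y₁ : Fin m₁ → SpaceTimeIdx L M × SectorLeg N => ∀ j, (Y₁ j).2 = σ₁ j),
            ‖kernel ℂ (sectorPreimage β F G) (k + m₁) (Fin.append Y Y₁)‖ =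
      ∑ W ∈ univ.filter (fun W : Fin (k + m₁) → SpaceTimeIdx L M × SectorLeg N =>
        (W (Fin.castAdd m₁ (Fin.castLE he 0)) = Y₀ ∧
          ∀ i' : Fin (e' + 1), (W (Fin.castAdd m₁ (Fin.castLE he i'))).2 = (Fin.cons Y₀.2 τ' : Fin (e' + 1) → SectorLeg N) i') ∧
          ∀ j, (W (Fin.natAdd k j)).2 = σ₁ j),
          ‖kernel ℂ (sectorPreimage β F G) (k + m₁) W‖ := by
    rw [sum_filter, sum_filter]
    simp_rw [sum_filter]
    rw [← sum_sum_append_eq]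
    refine sum_congr rfl fun Y _ => ?_
    simp only [Fin.append_left, Fin.append_right]
    split_ifs with h1
    · refine sum_congr rfl fun Y₁ _ => ?_
      by_cases hQ : ∀ j, (Y₁ j).2 = σ₁ j
      · rw [if_pos hQ, if_pos ⟨h1, hQ⟩]
      · rw [if_neg hQ, if_neg fun h' => hQ h'.2]
    · rw [sum_eq_zero]
      intro Y₁ _
      rw [if_neg fun h' => h1 h'.1]
  rw [hswap, hglue]
  refine le_trans (sum_le_sum_of_subset_of_nonneg (fun W hW => ?_) fun _ _ _ => norm_nonneg _)
    (sum_filter_prescribed_norm_kernel_sectorPreimage_le hβ F G (Fin.castAdd m₁ (Fin.castLE he 0)) Y₀ _)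
  simp only [mem_filter, mem_univ, true_and] at hW ⊢
  obtain ⟨⟨h0, hsec⟩, hlab⟩ := hW
  -- the prescription on the explicit block follows from `h0`/`hsec`
  have key : ∀ (i'' : Fin (e' + 1)) (t : SectorLeg N),
      t ∈ (Fin.cons (some Y₀.2) (fun j => some (τ' j)) : Fin (e' + 1) → Option (SectorLeg N)) i'' →
        (W (Fin.castAdd m₁ (Fin.castLE he i''))).2 = t := by
    intro i'' t
    refine Fin.cases ?_ (fun j => ?_) i''
    · intro ht
      simp only [Fin.cons_zero, Option.mem_def, Option.some.injEq] at ht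
      rw [← ht, h0]
    · intro ht
      simp only [Fin.cons_succ, Option.mem_def, Option.some.injEq] at ht
      rw [← ht, hsec, Fin.cons_succ]
  refine ⟨h0, fun i => Fin.addCases (fun i' => ?_) (fun j => ?_) i⟩
  · intro t ht
    rw [Fin.append_left] at ht
    by_cases h : (i' : ℕ) < e' + 1
    · rw [dif_pos h] at ht
      have h' := key ⟨i', h⟩ t ht
      rwa [show Fin.castLE he ⟨i', h⟩ = i' from Fin.ext rfl] at h'
    · rw [dif_neg h] at ht
      exact absurd ht (by simp)
  · intro t ht
    simp only [Fin.append_right, Option.mem_def, Option.some.injEq] at ht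
    rw [← ht, hlab j]

end Preimage

/-! ## §2 Lines `S(Ft)ᵀ·C_{sym t}·S(Ft)`, pinned at a free leg of `b` -/

section FamilyLabelsB

variable {L M N : ℕ} [NeZero L] {ι : Type*} [Fintype ι] [DecidableEq ι]

/-- Charges in `Fin 2` with `[a = 0] ↔ [b = 0]` are equal. -/
private theorem fin_two_eq_of_iff_B {a b : Fin 2} (h : a = 0 ↔ b = 0) : a = b := by
  rw [Fin.ext_iff, Fin.ext_iff, Fin.val_zero] at h
  rw [Fin.ext_iff]
  have ha := a.isLt
  have hb := b.isLt
  omega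

/-- **Hybrid form with a Gram tail, family keying, pinned at a free leg of `b`, output labels prescribed** (roles exchanged: `a` anchored through line
`0` with the sectors of its explicit legs prescribed and its output POSITIONS summed, `b` pinned at its output leg `p`). [cite: BenfattoGiulianiMastropietro2006, §2.8 (2.80)] -/
theorem sum_norm_kernel_crossContract_pullback_le_gramF_labels_of_b {k e' m m₀ m₁ : ℕ} (he : e' + 1 ≤ k) (β : ℝ) (Ft : Fin N → FreqMomentum L M → ℂ)
    {ρ₀ : ℕ} (hρ₀ : ∀ ω : Fin N, ((univ : Finset (Fin N)).filter fun ω' => ∃ q, Ft ω q * Ft ω' q ≠ 0).card ≤ ρ₀)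
    (sym : ι → FreqMomentum L M × Fin 2 → ℂ) (τ : Fin k → ι) (κ : ι → ℝ)
    (hκF : ∀ (s : ι) (Y : SpaceTimeIdx L M × SectorLeg N), Y.2.2 = 0 → ‖sectorGramF L M β Ft (sym s) Y‖ ≤ κ s)
    (hκG : ∀ (s : ι) (Y : SpaceTimeIdx L M × SectorLeg N), Y.2.2 = 1 → ‖sectorGramG L M β Ft (sym s) Y‖ ≤ κ s)
    (a b : GrassmannAlgebra ℂ (SpaceTimeIdx L M × SectorLeg N)) (s : Fin m → Fin 2)
    (hm₀ : (univ.filter fun i => s i = 0).card = m₀) (hm₁ : (univ.filter fun i => s i = 1).card = m₁) (p : Fin m) (hp : s p = 1)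
    (z : SpaceTimeIdx L M × SectorLeg N) (Ωo : Fin m → SectorLeg N) {α : ℝ}
    (hrow : ∀ X, ∑ Y, ‖((sectorSubMatrix L M β Ft).transpose * normalCovariance L M (sym (τ (Fin.castLE he 0))) * sectorSubMatrix L M β Ft) X Y‖ ≤ α)
    (hcol : ∀ Y, ∑ X, ‖((sectorSubMatrix L M β Ft).transpose * normalCovariance L M (sym (τ (Fin.castLE he 0))) * sectorSubMatrix L M β Ft) X Y‖ ≤ α)
    (δ : Fin e' → ℝ) (hδ : ∀ i, 0 ≤ δ i)
    (hent : ∀ (i : Fin e') X Y,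
      ‖((sectorSubMatrix L M β Ft).transpose * normalCovariance L M (sym (τ (Fin.castLE he i.succ))) * sectorSubMatrix L M β Ft) X Y‖ ≤ δ i)
    {Na Nb : ℝ} (hNa0 : 0 ≤ Na)
    (hNa : ∀ (X₀ : SpaceTimeIdx L M × SectorLeg N) (σ' : Fin e' → SectorLeg N) (σ₀ : Fin m₀ → SectorLeg N), ∑ x : Fin e' → SpaceTimeIdx L M,
      ∑ Z₀ ∈ univ.filter (fun Z₀ : Fin m₀ → SpaceTimeIdx L M × SectorLeg N => ∀ j, (Z₀ j).2 = σ₀ j),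
        ∑ X ∈ univ.filter (fun X : Fin k → SpaceTimeIdx L M × SectorLeg N =>
          (fun i => X (Fin.castLE he i)) = (Fin.cons X₀ (fun i => (x i, σ' i)) : Fin (e' + 1) → SpaceTimeIdx L M × SectorLeg N)),
            ‖kernel ℂ a (k + m₀) (Fin.append X Z₀)‖ ≤ Na)
    (hNb : ∀ (p₁ : Fin m₁) (σ₁ : Fin m₁ → SectorLeg N), ∑ Y : Fin k → SpaceTimeIdx L M × SectorLeg N,
      ∑ Y₁ ∈ univ.filter (fun Y₁ : Fin m₁ → SpaceTimeIdx L M × SectorLeg N => Y₁ p₁ = z ∧ ∀ j, (Y₁ j).2 = σ₁ j),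
        ‖kernel ℂ b (k + m₁) (Fin.append Y Y₁)‖ ≤ Nb) :
    ∑ Z ∈ univ.filter (fun Z : Fin m → SpaceTimeIdx L M × SectorLeg N => Z p = z ∧ ∀ j, (Z j).2 = Ωo j),
        ‖kernel ℂ (((List.ofFn fun i => grassmannLaplacian ℂ (crossCov ℂ
            ((sectorSubMatrix L M β Ft).transpose * normalCovariance L M (sym (τ i)) * sectorSubMatrix L M β Ft))).reverse).prod
          (dblCopy ℂ 0 a * dblCopy ℂ 1 b)) m (fun i => (Z i, s i))‖ ≤
      (((k + m₀).factorial * (k + m₁).factorial : ℝ) / (m.factorial * (k - (e' + 1)).factorial)) * (∑ t, κ t ^ 2) ^ (k - (e' + 1)) *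
        (α * (∏ i, δ i * ((4 * ρ₀ : ℕ) : ℝ)) * Na * Nb) := by
  classical
  refine sum_norm_kernel_crossContract_le_gram_labels_of_eq_one (fun Y : SpaceTimeIdx L M × SectorLeg N => decide (Y.2.2 = 0))
    (fun t => (sectorSubMatrix L M β Ft).transpose * normalCovariance L M (sym t) * sectorSubMatrix L M β Ft)
    (fun t X Y hq => pullback_normalCovariance_apply_of_charge_eq β Ft (sym t) (fin_two_eq_of_iff_B (by simpa using hq)))
    (fun t => sectorGramF L M β Ft (sym t)) (fun t => sectorGramG L M β Ft (sym t)) κ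
    (fun t X hX => hκF t X (by simpa using hX)) (fun t Y hY => hκG t Y ?_)
    (fun t X Y hX hY => contr_pullback_normalCovariance_eq_inner β Ft (sym t) (by simpa using hX) ?_)
    he (fun i => (sectorSubMatrix L M β Ft).transpose * normalCovariance L M (sym (τ i)) * sectorSubMatrix L M β Ft) τ (fun i _ => rfl)
    a b s hm₀ hm₁ p hp z Ωo (sum_norm_contr_le _ hrow hcol)
    (fun _ σ τ'' => if (∃ q, Ft σ.1.1 q * Ft τ''.1.1 q ≠ 0) then (1 : ℝ) else 0) (fun _ σ τ'' => by positivity)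
    δ (fun _ => ((4 * ρ₀ : ℕ) : ℝ)) hδ
    (fun i X Y => norm_contr_le_indicator_of_support _ (fun σ τ'' : SectorLeg N => ∃ q, Ft σ.1.1 q * Ft τ''.1.1 q ≠ 0)
      (fun σ τ'' ⟨q, hq⟩ => ⟨q, by rwa [mul_comm] at hq⟩) (hδ i) (hent i)
      (fun X Y hXY => exists_mul_ne_zero_of_pullback_normalCovariance_ne_zero β Ft (sym _) hXY) X Y)
    (fun _ τ'' => sum_indicator_le_of_card_le' (fun σ τ'' : SectorLeg N => ∃ q, Ft σ.1.1 q * Ft τ''.1.1 q ≠ 0)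
      (fun σ τ'' ⟨q, hq⟩ => ⟨q, by rwa [mul_comm] at hq⟩) (fun σ' => ?_) τ'') hNa0 hNa hNb
  · have h2 : (Y.2.2 : Fin 2) ≠ 0 := by simpa using hY
    omega
  · have h2 : (Y.2.2 : Fin 2) ≠ 0 := by simpa using hY
    omega
  · exact (card_filter_sectorLeg_le fun ω' => ∃ q, Ft σ'.1.1 q * Ft ω' q ≠ 0).trans (Nat.mul_le_mul_left 4 (hρ₀ σ'.1.1))

end FamilyLabelsB

/-! ## §3 Engine currency, family keying, both pinnings -/

section Engine

variable {L M N : ℕ} [NeZero L] {ι : Type*} [Fintype ι] [DecidableEq ι]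

/-- **Hybrid form with a Gram tail between two sector preimages, in engine currency, family keying** (pinned output leg from `Ga`, output labels
prescribed `Ωo`): `Ga` at the prescription «contracted legs free, outputs `σ₀`» bounded by `Na` for every `σ₀`, `Gb` at «line-`0` leg `ω₀`, explicit
legs `τ'`, Gram legs free, outputs `σ₁`» bounded by `Nb` for every `(ω₀, τ', σ₁)`:
`Σ_{Z : Z p = z, labels Ωo} ‖kernel (…) m (Z,s)‖ ≤ ((k+m₀)!(k+m₁)!/(m!·(k−e'−1)!))·(Σκ²)^{k−e'−1}·α·∏_{i<e'}(δ_i·4ρ₀)·(εNa)·(εNb)`.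
[cite: BenfattoGiulianiMastropietro2006, §2.8 (2.80)] -/
theorem sum_norm_kernel_crossContract_sectorPreimage_le_gramF_labels {k e' m m₀ m₁ : ℕ} (he : e' + 1 ≤ k) {β : ℝ} (hβ : 0 ≤ β)
    (F Ft : Fin N → FreqMomentum L M → ℂ)
    {ρ₀ : ℕ} (hρ₀ : ∀ ω : Fin N, ((univ : Finset (Fin N)).filter fun ω' => ∃ q, Ft ω q * Ft ω' q ≠ 0).card ≤ ρ₀)
    (sym : ι → FreqMomentum L M × Fin 2 → ℂ) (τ : Fin k → ι) (κ : ι → ℝ)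
    (hκF : ∀ (s : ι) (Y : SpaceTimeIdx L M × SectorLeg N), Y.2.2 = 0 → ‖sectorGramF L M β Ft (sym s) Y‖ ≤ κ s)
    (hκG : ∀ (s : ι) (Y : SpaceTimeIdx L M × SectorLeg N), Y.2.2 = 1 → ‖sectorGramG L M β Ft (sym s) Y‖ ≤ κ s)
    (Ga Gb : HubbardGrassmann L M) (s : Fin m → Fin 2)
    (hm₀ : (univ.filter fun i => s i = 0).card = m₀) (hm₁ : (univ.filter fun i => s i = 1).card = m₁) (p : Fin m) (hp : s p = 0)
    (z : SpaceTimeIdx L M × SectorLeg N) (Ωo : Fin m → SectorLeg N) {α : ℝ}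
    (hrow : ∀ X, ∑ Y, ‖((sectorSubMatrix L M β Ft).transpose * normalCovariance L M (sym (τ (Fin.castLE he 0))) * sectorSubMatrix L M β Ft) X Y‖ ≤ α)
    (hcol : ∀ Y, ∑ X, ‖((sectorSubMatrix L M β Ft).transpose * normalCovariance L M (sym (τ (Fin.castLE he 0))) * sectorSubMatrix L M β Ft) X Y‖ ≤ α)
    (δ : Fin e' → ℝ) (hδ : ∀ i, 0 ≤ δ i)
    (hent : ∀ (i : Fin e') X Y,
      ‖((sectorSubMatrix L M β Ft).transpose * normalCovariance L M (sym (τ (Fin.castLE he i.succ))) * sectorSubMatrix L M β Ft) X Y‖ ≤ δ i)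
    {Na Nb : ℝ} (hNb0 : 0 ≤ Nb)
    (hNa : ∀ σ₀ : Fin m₀ → SectorLeg N, hubbardSectorKernelNorm L M β F (prescribedTuples univ
      (Fin.append (fun _ : Fin k => (none : Option (SectorLeg N))) (fun j => some (σ₀ j)))) Ga ≤ Na)
    (hNb : ∀ (ω₀ : SectorLeg N) (τ' : Fin e' → SectorLeg N) (σ₁ : Fin m₁ → SectorLeg N), hubbardSectorKernelNorm L M β F (prescribedTuples univ
      (Fin.append (fun i : Fin k => if h : (i : ℕ) < e' + 1 then
        (Fin.cons (some ω₀) (fun j => some (τ' j)) : Fin (e' + 1) → Option (SectorLeg N)) ⟨i, h⟩ else none) (fun j => some (σ₁ j)))) Gb ≤ Nb) :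
    ∑ Z ∈ univ.filter (fun Z : Fin m → SpaceTimeIdx L M × SectorLeg N => Z p = z ∧ ∀ j, (Z j).2 = Ωo j),
        ‖kernel ℂ (((List.ofFn fun i => grassmannLaplacian ℂ (crossCov ℂ
            ((sectorSubMatrix L M β Ft).transpose * normalCovariance L M (sym (τ i)) * sectorSubMatrix L M β Ft))).reverse).prod
          (dblCopy ℂ 0 (sectorPreimage β F Ga) * dblCopy ℂ 1 (sectorPreimage β F Gb))) m (fun i => (Z i, s i))‖ ≤
      (((k + m₀).factorial * (k + m₁).factorial : ℝ) / (m.factorial * (k - (e' + 1)).factorial)) * (∑ t, κ t ^ 2) ^ (k - (e' + 1)) *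
        (α * (∏ i, δ i * ((4 * ρ₀ : ℕ) : ℝ)) * (imagTimeWeight β M * Na) * (imagTimeWeight β M * Nb)) := by
  have hε : 0 ≤ imagTimeWeight β M := imagTimeWeight_nonneg hβ M
  exact sum_norm_kernel_crossContract_pullback_le_gramF_labels he β Ft hρ₀ sym τ κ hκF hκG (sectorPreimage β F Ga) (sectorPreimage β F Gb) s
    hm₀ hm₁ p hp z Ωo hrow hcol δ hδ hent (mul_nonneg hε hNb0)
    (fun p₀ σ₀ => (sum_pinned_labels_norm_kernel_sectorPreimage_le hβ F Ga p₀ z σ₀).trans (mul_le_mul_of_nonneg_left (hNa σ₀) hε))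
    fun Y₀ τ' σ₁ => (sum_sum_sum_filter_castLE_labels_norm_kernel_sectorPreimage_le hβ F Gb he Y₀ τ' σ₁).trans
      (mul_le_mul_of_nonneg_left (hNb Y₀.2 τ' σ₁) hε)

/-- **Hybrid form with a Gram tail between two sector preimages, engine currency, family keying, pinned at an output leg of `Gb`** (roles exchanged:
`Ga` at «line-`0` leg `ω₀`, explicit legs `σ'`, Gram legs free, outputs `σ₀`» bounded by `Na`, `Gb` at «contracted legs free, outputs `σ₁`» bounded by `Nb`).
[cite: BenfattoGiulianiMastropietro2006, §2.8 (2.80)] -/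
theorem sum_norm_kernel_crossContract_sectorPreimage_le_gramF_labels_of_b {k e' m m₀ m₁ : ℕ} (he : e' + 1 ≤ k) {β : ℝ} (hβ : 0 ≤ β)
    (F Ft : Fin N → FreqMomentum L M → ℂ)
    {ρ₀ : ℕ} (hρ₀ : ∀ ω : Fin N, ((univ : Finset (Fin N)).filter fun ω' => ∃ q, Ft ω q * Ft ω' q ≠ 0).card ≤ ρ₀)
    (sym : ι → FreqMomentum L M × Fin 2 → ℂ) (τ : Fin k → ι) (κ : ι → ℝ)
    (hκF : ∀ (s : ι) (Y : SpaceTimeIdx L M × SectorLeg N), Y.2.2 = 0 → ‖sectorGramF L M β Ft (sym s) Y‖ ≤ κ s)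
    (hκG : ∀ (s : ι) (Y : SpaceTimeIdx L M × SectorLeg N), Y.2.2 = 1 → ‖sectorGramG L M β Ft (sym s) Y‖ ≤ κ s)
    (Ga Gb : HubbardGrassmann L M) (s : Fin m → Fin 2)
    (hm₀ : (univ.filter fun i => s i = 0).card = m₀) (hm₁ : (univ.filter fun i => s i = 1).card = m₁) (p : Fin m) (hp : s p = 1)
    (z : SpaceTimeIdx L M × SectorLeg N) (Ωo : Fin m → SectorLeg N) {α : ℝ}
    (hrow : ∀ X, ∑ Y, ‖((sectorSubMatrix L M β Ft).transpose * normalCovariance L M (sym (τ (Fin.castLE he 0))) * sectorSubMatrix L M β Ft) X Y‖ ≤ α)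
    (hcol : ∀ Y, ∑ X, ‖((sectorSubMatrix L M β Ft).transpose * normalCovariance L M (sym (τ (Fin.castLE he 0))) * sectorSubMatrix L M β Ft) X Y‖ ≤ α)
    (δ : Fin e' → ℝ) (hδ : ∀ i, 0 ≤ δ i)
    (hent : ∀ (i : Fin e') X Y,
      ‖((sectorSubMatrix L M β Ft).transpose * normalCovariance L M (sym (τ (Fin.castLE he i.succ))) * sectorSubMatrix L M β Ft) X Y‖ ≤ δ i)
    {Na Nb : ℝ} (hNa0 : 0 ≤ Na)
    (hNa : ∀ (ω₀ : SectorLeg N) (σ' : Fin e' → SectorLeg N) (σ₀ : Fin m₀ → SectorLeg N), hubbardSectorKernelNorm L M β F (prescribedTuples univ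
      (Fin.append (fun i : Fin k => if h : (i : ℕ) < e' + 1 then
        (Fin.cons (some ω₀) (fun j => some (σ' j)) : Fin (e' + 1) → Option (SectorLeg N)) ⟨i, h⟩ else none) (fun j => some (σ₀ j)))) Ga ≤ Na)
    (hNb : ∀ σ₁ : Fin m₁ → SectorLeg N, hubbardSectorKernelNorm L M β F (prescribedTuples univ
      (Fin.append (fun _ : Fin k => (none : Option (SectorLeg N))) (fun j => some (σ₁ j)))) Gb ≤ Nb) :
    ∑ Z ∈ univ.filter (fun Z : Fin m → SpaceTimeIdx L M × SectorLeg N => Z p = z ∧ ∀ j, (Z j).2 = Ωo j),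
        ‖kernel ℂ (((List.ofFn fun i => grassmannLaplacian ℂ (crossCov ℂ
            ((sectorSubMatrix L M β Ft).transpose * normalCovariance L M (sym (τ i)) * sectorSubMatrix L M β Ft))).reverse).prod
          (dblCopy ℂ 0 (sectorPreimage β F Ga) * dblCopy ℂ 1 (sectorPreimage β F Gb))) m (fun i => (Z i, s i))‖ ≤
      (((k + m₀).factorial * (k + m₁).factorial : ℝ) / (m.factorial * (k - (e' + 1)).factorial)) * (∑ t, κ t ^ 2) ^ (k - (e' + 1)) *
        (α * (∏ i, δ i * ((4 * ρ₀ : ℕ) : ℝ)) * (imagTimeWeight β M * Na) * (imagTimeWeight β M * Nb)) := by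
  have hε : 0 ≤ imagTimeWeight β M := imagTimeWeight_nonneg hβ M
  exact sum_norm_kernel_crossContract_pullback_le_gramF_labels_of_b he β Ft hρ₀ sym τ κ hκF hκG (sectorPreimage β F Ga) (sectorPreimage β F Gb) s
    hm₀ hm₁ p hp z Ωo hrow hcol δ hδ hent (mul_nonneg hε hNa0)
    (fun X₀ σ' σ₀ => (sum_sum_sum_filter_castLE_labels_norm_kernel_sectorPreimage_le hβ F Ga he X₀ σ' σ₀).trans
      (mul_le_mul_of_nonneg_left (hNa X₀.2 σ' σ₀) hε))
    fun p₁ σ₁ => (sum_pinned_labels_norm_kernel_sectorPreimage_le hβ F Gb p₁ z σ₁).trans (mul_le_mul_of_nonneg_left (hNb σ₁) hε)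

end Engine

end Summit.HubbardSuperconductivity.HubbardSuperconductivity.Theorems.KLRegimeWick

end
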